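import Mathlib
import HarnessLib
import HarnessLib.Audit
import Summits.NavierStokesRegularity.Statement
import Literature.Analysis.FluidPDE.ClassicalSolution
import Literature.Analysis.FluidPDE.LerayHopf
import Literature.Analysis.FluidPDE.NSWave0
import Literature.Analysis.FluidPDE.VectorCalculus
import Literature.Analysis.FluidPDE.LocalTypeI
import Summits.NavierStokesRegularity.NavierStokesRegularity.Theorems.NoBlowupToClay

/-!
Route: HalfHolderEnergy

DORMANT since 2026-09-04T08:35:50Z (reconciler: no traction for 5 d (last activity statement-attached at 2026-08-30T07:34:28Z); parked, not closed — `ledger route dormant route-NavierStokesRegularity-HalfHolderEnergy --off` to reactivat) — unstaffed, not closed; items shared with open routes are served there. `ledger route dormant <id> --off` reactivates.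

# Route HalfHolderEnergy — Energy is half-Hölder at a first blow-up; window law runs the Type-I
bridge

It suffices to show X = X1 ∧ X2 with X1 = EnergyHalfHolder (the WINDOW QUARTER LAW: at a first
blow-up time T of a
classical Leray–Hopf solution from a rapidly decaying datum, the dissipation of every time window
obeys
∫_a^b ∫|curl u|² ≤ K √(b−a), i.e. the kinetic energy t ↦ ½‖u(t)‖² is uniformly ½-Hölder on [0,T])
and X2 =
NoLocalTypeISingularity (the shared Liouville-side residual stmt-10480: no suitable weak solution
has a local
Type-I singular point). X1 is the weakest statement in the energy-curve currency that still runs the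
Seregin/Albritton–Barker Type-I machinery: it is strictly implied by the shelf residual
EnstrophyQuarterLaw
(stmt-1574, slice law Ω(t) ≤ K/√(T−t)) and does not imply it. Lens wuc: X1 is a consequence of S not
known today.
Lean: `EnergyHalfHolder ∧ NoLocalTypeISingularity`

## Assembly
Pure logic over the tree theorem
`Summit.NavierStokesRegularity.NavierStokesRegularity.Theorems.navierStokesRegularity_of_noBlowup`
(Theorems/NoBlowupToClay.lean: no finite-time blow-up of classical Leray–Hopf solutions from rapidly
decaying data ⇒
Clay (A)): given a classical LH solution on [0,T) with no smooth extension past T, EnergyHalfHolder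
supplies the window
constant, HolderBridge turns it into a local Type-I singular point, NoLocalTypeISingularity denies
it; contradiction.
The deciding theorem `closes` in glue.lean is this argument (by_contra on HasSmoothExtensionPast).

Rationale: WHY THIS LINE. The slice law EQL (routes LerayQuarterDissipation, CalmSliceGate, QuarterLogPincer,
EfficiencyFloor, SWB) asks the
enstrophy to sit at Leray's lower rate c ν^{3/2}(T−t)^{-1/2} [corpus:book:robinson2016 p.108, Lemma
6.11] at EVERY
time; the bridge to a Type-I singular point (tree: `stretchingWellBinding_typeIBridge_proof`,
Albritton–Barker
Lemma 2.6 `albrittonBarker2019_lemma_2_6_holds.of_cknE_le`, arXiv:1811.00502 §2; Seregin 2007 =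
[corpus:book:seregin2014
p.113, Prop. 3.11(ii)]) only ever consumes the scaled dissipation E(z,r) = r⁻¹∬_{Q_r(z)}|∇u|², a
WINDOW integral. So the
bridge runs verbatim from the window law, which tolerates thin super-rate spikes (a Riccati-extremal
spike of height
H has forced width ν³/H² and mass ν³/H, so HHE ⇏ EQL) and is exactly "energy ½-Hölder up to T" — a
statement about
the one globally controlled quantity. Converters (support-level, not filed): EQL ⇒ HHE
(∫(T−s)^{-1/2}); HHE ∧ NoTypeII
⇒ EQL (Gronwall over [2t−T,t] under ‖u‖_∞ ≤ C/√(T−t)); hence EQL ⟺ HHE ∧ NoTypeII, a factorisation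
of the shared
residual of five routes into an energy-curve half and a rate half. Imported area:
ε-regularity/Morrey theory of
suitable weak solutions (CKN 1982, Seregin 2006/07, Albritton–Barker 2019). Nothing in the negatives
index is near.

RANKED CRUXES. #2 EnergyHalfHolder (crux) — Window quarter law / energy ½-Hölder: for ν>0, T>0 and a
maximal classical solution u on [0,T) (no smooth extension past T) that is Leray–Hopf from a rapidly
decaying datum, ∃K ∀0≤a≤b≤T: ∫_a^b ∫|curl u(t)|² dx dt ≤ K√(b−a). [difficulty: open-problem] (why it
might fail: A Type-II cascade whose k-th burst dissipates energy e_k over duration τ_k with e_k/√τ_k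
→ ∞ (Tao's averaged blow-up has this: (e_k N_k)^{3/4} → ∞) would be a genuine-NS counterexample; no
energy-class mechanism forbids it.) [arXiv:1811.00502, arXiv:1402.0290,
doi:10.1017/cbo9781139095143, doi:10.1142/9314]
#3 NoLocalTypeISingularity (crux) — Shared residual stmt-NavierStokesRegularity-10480 (verbatim): no
suitable weak solution (ν=1) in a parabolic ball has its centre as a backward singular point with
Albritton–Barker's Type-I quantity finite — the negation of the registered open statement
LocalTypeISingularityExists; expected from the KNSS bounded-ancient Liouville conjecture.
[difficulty: open-problem] (why it might fail: A discretely self-similar or Type-I singular suitable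
weak solution (finite energy not required; the witnesses sought by Blowup stmt-0155 /
DssFarFieldSlaving) refutes it; only axisymmetric, λ-DSS near 1 and self-similar cases are
excluded.) [arXiv:1811.00502, doi:10.1007/s11511-009-0039-6, doi:10.1142/9314]
#9 HolderBridge (support) — The window law runs the Type-I bridge: under the hypotheses of
EnergyHalfHolder plus its conclusion (∃K window bound), some suitable weak solution has a local
Type-I singular point. Proof plan = `stretchingWellBinding_typeIBridge_proof` with the zoom α•stPull
β R T x₀ u (R=√(νT)) at a CKN singular point of the non-extendable solution; the window bound gives
cknE(Q') ≤ K ν^{-3/2} on EVERY parabolic sub-ball (Tonelli + |∇u|_F ≤ |curl u| in L²), then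
`albrittonBarker2019_lemma_2_6_holds.of_cknE_le`. [difficulty: M] [arXiv:1811.00502,
doi:10.1142/9314]

TWO-LAYER PLAN. EnergyHalfHolder ⇐ ShortWindowLaw → BudgetExtension → EnergyHalfHolder (windows of
length ≤ δ carry the content; long
windows are paid by Leray's budget ∫_0^T∫|∇u|² ≤ ‖u₀‖²/(2ν)) — the registered birth skeleton.
Foreseen second split of
ShortWindowLaw: (uniform local Morrey bound sup_{z, r≤r₀} E(z,r) ≤ M) ∧ (bounded dissipation
multiplicity: at each
scale r the set {E(·,r) ≥ ε} is covered by N parabolic balls, N uniform) ∧ (far-field smallness, CKN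
Thm D) → ShortWindowLaw
by a covering argument. HolderBridge ⇐ (zoom packaging, = SWB steps 1–3) → (window ⇒ sub-ball E
bound) → HolderBridge.

KILL CRITERIA. A genuine Navier–Stokes (not averaged, not NSI) Leray–Hopf blow-up scenario, rigorous
or certified-numerical, whose
dissipation bursts satisfy e_k/√τ_k → ∞ refutes EnergyHalfHolder and closes the route (close
--reason
refuted:EnergyHalfHolder); the factorisation EQL ⟺ HHE ∧ NoTypeII then tells the five EQL routes
which half died.
A Type-I/DSS singular suitable weak solution refutes NoLocalTypeISingularity (shared; all
Type-I-exclusion routes die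
together). EQL (1574) proved elsewhere moots EnergyHalfHolder (EQL ⇒ HHE is one integration); KNSS
Liouville proved
elsewhere closes NoLocalTypeISingularity via AlbrittonBarkerForward.

NOT DECOMPOSED YET. The covering/multiplicity split of ShortWindowLaw (constants ε of CKN Prop. 2,
the multiplicity N(K,ν,‖u₀‖₂)) and the
finite-singular-set converter HHE ⇒ #Sing(T) ≤ N are layer-2; the converters EQL ⇒ HHE and HHE ∧
NoTypeII ⇒ EQL are
support lemmas to be attached with --supports, not items. No constant K is hand-picked: every
statement is ∃K.

CHEAPEST FALSIFIER. Dissipation-budget accounting of any explicit cascade: for Tao's averaged-NS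
blow-up (arXiv:1402.0290, §5–6) the
k-th transfer dissipates e_k ≈ energy at frequency N_k over τ_k ≈ (e_k^{1/2} N_k^{5/2})^{-1}·N_k…
giving e_k/√τ_k ~
(e_k N_k)^{3/4} → ∞ — HHE FAILS there (ran by hand; consistent with the barrier: HHE must use
genuine-NS structure).
The same bookkeeping on Hou's 2022/23 axisymmetric NS candidate (energy curve E(t) from the
published runs: is
sup|E(b)−E(a)|/√(b−a) bounded as t→T?) is the cheapest real-NS test; a refuter with the data decides
it in an hour.

NUMBERS. Leray 1934 lower rate ‖∇u(t)‖² ≥ c ν^{3/2}(T−t)^{-1/2} [corpus:book:robinson2016 p.108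
Lemma 6.11]; box dimension of
singular times ≤ 1/2 [corpus:book:robinson2016 p.127 Thm 8.13]; Leray budget 2ν∫_0^T‖∇u‖² ≤ ‖u₀‖²;
HHE constant is
dimensionally K = κ ν^{3/2}, κ dimensionless; CKN ε-regularity threshold on limsup r⁻¹∬_{Q_r}|∇u|²
(CKN Prop. 2).

DEFINITION REQUESTS. None: all notions exist (IsMaximalSmoothSolution, IsLerayHopfOn,
HasRapidSpatialDecay, curl, IsLocalTypeISingularPoint).

Novelty: Searches (2026-08-28): lit search --hybrid "enstrophy blow-up rate Navier-Stokes Type I" (8 docs: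
Majda–Bertozzi, Foias et al., Doering–Gibbon; no window law); lit search --hybrid "Leray lower bound
blow-up rate (T-t)^{-1/4}" (Seregin 2014 p.130, RRS 2016 p.163); lit vsearch "kinetic energy Hölder
continuous exponent one half up to blow-up time" (10 docs, none stating it); lit search --source all
"Navier-Stokes blow-up rate enstrophy type I H^1 norm" (crossref: Chen–Strain–Tsai–Yau 2008
doi:10.1093/imrn/rnn016 lower bounds only); lit search --source all "number of singular points
Navier-Stokes Type I" (Seregin 2001 doi:10.1002/cpa.3002, Wang–Zhang 2014
doi:10.1007/s11854-014-0016-7, Barker 2024 doi:10.1090/bproc/193 — velocity-side scale-invariant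
bounds); lit galaxy search "blow-up rate of the enstrophy|enstrophy blow-up rate|optimal blow-up
rate" --star all (2 rows, unrelated); lit galaxy search "Hölder continuity of the energy|energy is
Hölder continuous|…exponent 1/2" --star all (3 rows, unrelated); ledger negatives (5, none near);
tree rg HalfHolder/energyHolder (0).
Nearest prior art found: [corpus:book:seregin2014 p.113 Prop. 3.11(ii)] = Seregin 2007 (one bounded
scaled energy quantity sup_r E(z,r) ⇒ Type I at z) and arXiv:1811.00502 Lemma 2.6 (in tree, proved)
— the LOCAL pointwise-in-z version of the bridge; in-tree routes
LerayQuarterDissipation/CalmSliceGate/QuarterLogPincer/EfficiencyFloor/StretchingWellBinding all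
land on the SLICE law EQL (stmt-1574).
Delta: the  [refs: 10.1093/imrn/rnn016, 10.1002/cpa.3002, 10.1007/s11854-014-0016-7, 10.1090/bproc/193, 1811.00502, doi:10.1093/imrn/rnn016, doi:10.1002/cpa.3002, doi:10.1007/s11854-014-0016-7, doi:10.1090/bproc/193, book:seregin2014]

Barriers (technique_class: blowup-rescaling, epsilon-regularity, liouville-rigidity): - technique_class: blowup-rescaling, epsilon-regularity, liouville-rigidity
- Literature.Barriers.NavierStokesRegularity.TaoAveragedBlowup: it does not evade for the PROOF of
EnergyHalfHolder (an energy-curve a-priori statement must use structure absent from Tao's averaged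
class — and indeed HHE is FALSE for the averaged cascade, so the crux separates NS from averaged
NS); the bridge half uses ε-regularity/backward uniqueness, outside the averaged class. The bet is
that the window law is the weakest energy-curve statement that still decides S given (L), hence the
right place to look for an NS-specific mechanism or a counterexample.
- Literature.Barriers.NavierStokesRegularity.AveragedTypeIBlowup: a Type-I averaged blow-up obeying
the energy identity exists (tree theorem) ⇒ HolderBridge + NoLocalTypeISingularity must use
NS-specific input; they do (CKN/Lin ε-regularity, ESŠ backward uniqueness behind (L));
EnergyHalfHolder is not claimed for averaged equations.
- Literature.Barriers.NavierStokesRegularity.NSITypeIIBlowup: «suitability is rate-blind» kills rate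
conclusions proved from the local energy inequality alone; EnergyHalfHolder is a dissipation-rate
conclusion ⇒ inside: its proof must use the Navier–Stokes EQUATION (vorticity transport / pressure
law), not the NSI axiomatics. Recorded as the price.
- Literature.Barriers.NavierStokesRegularity.EnergySupercriticality: energy and cumulative
dissipation are supercritical; HHE is the scale-INVARIANT sharpening (K ~ ν^{3/2} d

History (route lifecycle, newest last):
- 2026-09-04T08:35:50Z · DORMANT — reconciler: no traction for 5 d (last activity statement-attached at 2026-08-30T07:34:28Z); parked, not closed — `ledger route dormant route-NavierStokesRegular (operator:999:401943)

sub-problem: NavierStokesRegularity · status: dormant · opened planner-ns-idea-9-g0-0 2026-08-28T03:10:27Z · rev 0 · ledger route-NavierStokesRegularity-HalfHolderEnergy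
GENERATED by the gate from the ledger (D-0016/17). Provers cite these decls: `theorem foo : Summit.NavierStokesRegularity.NavierStokesRegularity.Theses.HalfHolderEnergy.<Decl> := …` in Summits/NavierStokesRegularity/NavierStokesRegularity/Theorems/<Name>.lean.
-/

namespace Summit.NavierStokesRegularity.NavierStokesRegularity.Theses.HalfHolderEnergy

open scoped BigOperators Topology Manifold Classical MeasureTheory ProbabilityTheory Matrix InnerProductSpace ComplexConjugate ContinuousMap
open Filter Set Function TopologicalSpace MeasureTheory

attribute [summit_statement] _root_.NavierStokesRegularity

open Literature.NS

/-- item stmt-NavierStokesRegularity-25161 · crux · rank 2 · open · by planner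
why it might fail: A Type-II cascade whose k-th burst dissipates energy e_k over duration τ_k with e_k/√τ_k → ∞ (Tao's averaged blow-up has this: (e_k N_k)^{3/4} → ∞) would be a genuine-NS counterexample; no energy-class mechanism forbids it.
sources: arXiv:1811.00502, arXiv:1402.0290, doi:10.1017/cbo9781139095143, doi:10.1142/9314
[crux] Window quarter law / energy ½-Hölder: for ν>0, T>0 and a maximal classical solution u on
[0,T) (no smooth extension past T) that is Leray–Hopf from a rapidly decaying datum, ∃K ∀0≤a≤b≤T:
∫_a^b ∫|curl u(t)|² dx dt ≤ K√(b−a). [difficulty: open-problem] -/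
@[route_item "route-NavierStokesRegularity-HalfHolderEnergy"]
def EnergyHalfHolder : Prop :=
  ∀ (ν T : ℝ), 0 < ν → 0 < T → ∀ (u : ℝ → EuclideanSpace ℝ (Fin 3) → EuclideanSpace ℝ (Fin 3)) (p : ℝ → EuclideanSpace ℝ (Fin 3) → ℝ), Literature.Analysis.FluidPDE.IsMaximalSmoothSolution ν 0 u p T → Literature.Analysis.FluidPDE.IsLerayHopfOn T ν 0 (u 0) u → Literature.Analysis.FluidPDE.HasRapidSpatialDecay (u 0) → ∃ K : ℝ, ∀ a b : ℝ, 0 ≤ a → a ≤ b → b ≤ T → ∫⁻ t in Set.Ioo a b, ∫⁻ x, ‖Literature.Analysis.FluidPDE.curl (u t) x‖ₑ ^ 2 ≤ ENNReal.ofReal (K * Real.sqrt (b - a))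

/-- item stmt-NavierStokesRegularity-10480 · crux · rank 3 · open · by planner
why it might fail: A discretely self-similar or Type-I singular suitable weak solution (finite energy not required; the witnesses sought by Blowup stmt-0155 / DssFarFieldSlaving) refutes it; only axisymmetric, λ-DSS near 1 and self-similar cases are excluded.
sources: arXiv:1811.00502, doi:10.1007/s11511-009-0039-6, doi:10.1142/9314
[crux] No Type-I singular point: the first bullet of Albritton-Barker 2019 Thm 1.1 NEGATED - no
suitable weak solution (nu=1) in a parabolic ball Q(z,r0) has its centre as a backward singular
point with AB's Type-I quantity I(Q(z,r0)) = sup over parabolic sub-balls of A+C+D+E finite.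
RESTATED 2026-08-15 (route-repair, staffability): the body of the registered open statement
Literature.Analysis.FluidPDE.LocalTypeISingularityExists (LocalTypeI.lean, [status: open]) is
INLINED over the printed notion IsLocalTypeISingularPoint, so that no closed unproved Literature
Prop sits in the route's used-constants cone; the item is Iff.rfl-equal to `¬
LocalTypeISingularityExists` (planner Check.lean rc 0), so every in-tree lemma about that name
applies verbatim (e.g. refutation via
localTypeISingularityExists_of_nontrivialMildAncientTypeIExists). Status: OPEN; expected TRUE under
the KNSS Liouville conjecture (L) (stmt-0057, route TypeILiouville) via AB's forward direction
(named fact AlbrittonBarkerForward = Seregin-Sverak rescaling) and equivalent, under that fact, to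
(L') = not NontrivialMildAncientTypeIExists (AB reverse direction PROVED in tree). Known cases:
axisymmetric (SereginSverak2009 -/
@[route_item "route-NavierStokesRegularity-HalfHolderEnergy"]
def NoLocalTypeISingularity : Prop :=
  ¬ ∃ (r₀ : ℝ) (z : ℝ × EuclideanSpace ℝ (Fin 3)) (u : ℝ → EuclideanSpace ℝ (Fin 3) → EuclideanSpace ℝ (Fin 3)) (p : ℝ → EuclideanSpace ℝ (Fin 3) → ℝ), Literature.Analysis.FluidPDE.IsLocalTypeISingularPoint r₀ z u p

/-- item stmt-NavierStokesRegularity-25162 · support · rank 9 · closed · proved by Summit.NavierStokesRegularity.NavierStokesRegularity.Theorems.halfHolderEnergy_holderBridge_proof (prover) · by planner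
sources: arXiv:1811.00502, doi:10.1142/9314
[support] The window law runs the Type-I bridge: under the hypotheses of EnergyHalfHolder plus its
conclusion (∃K window bound), some suitable weak solution has a local Type-I singular point. Proof
plan = `stretchingWellBinding_typeIBridge_proof` with the zoom α•stPull β R T x₀ u (R=√(νT)) at a
CKN singular point of the non-extendable solution; the window bound gives cknE(Q') ≤ K ν^{-3/2} on
EVERY parabolic sub-ball (Tonelli + |∇u|_F ≤ |curl u| in L²), then
`albrittonBarker2019_lemma_2_6_holds.of_cknE_le`. [difficulty: M] -/
@[route_item "route-NavierStokesRegularity-HalfHolderEnergy"]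
def HolderBridge : Prop :=
  ∀ (ν T : ℝ), 0 < ν → 0 < T → ∀ (u : ℝ → EuclideanSpace ℝ (Fin 3) → EuclideanSpace ℝ (Fin 3)) (p : ℝ → EuclideanSpace ℝ (Fin 3) → ℝ), Literature.Analysis.FluidPDE.IsMaximalSmoothSolution ν 0 u p T → Literature.Analysis.FluidPDE.IsLerayHopfOn T ν 0 (u 0) u → Literature.Analysis.FluidPDE.HasRapidSpatialDecay (u 0) → (∃ K : ℝ, ∀ a b : ℝ, 0 ≤ a → a ≤ b → b ≤ T → ∫⁻ t in Set.Ioo a b, ∫⁻ x, ‖Literature.Analysis.FluidPDE.curl (u t) x‖ₑ ^ 2 ≤ ENNReal.ofReal (K * Real.sqrt (b - a))) → ∃ (r₀ : ℝ) (z : ℝ × EuclideanSpace ℝ (Fin 3)) (v : ℝ → EuclideanSpace ℝ (Fin 3) → EuclideanSpace ℝ (Fin 3)) (q : ℝ → EuclideanSpace ℝ (Fin 3) → ℝ), Literature.Analysis.FluidPDE.IsLocalTypeISingularPoint r₀ z v q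

-- `HolderBridge` holds: proved by `Summit.NavierStokesRegularity.NavierStokesRegularity.Theorems.halfHolderEnergy_holderBridge_proof` (its module imports this route file, so no `_holds` link can be stated here).

/-- item stmt-NavierStokesRegularity-25163 · assembly · rank 1 · closed · proved by Summit.NavierStokesRegularity.NavierStokesRegularity.Theorems.halfHolderEnergy_assembly_proof (prover) · by planner
sources: arXiv:1811.00502
[assembly] EnergyHalfHolder → HolderBridge → NoLocalTypeISingularity → NavierStokesRegularity. -/
@[route_item "route-NavierStokesRegularity-HalfHolderEnergy"]
def Assembly : Prop :=
  EnergyHalfHolder → HolderBridge → NoLocalTypeISingularity → NavierStokesRegularity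

-- `Assembly` holds: proved by `Summit.NavierStokesRegularity.NavierStokesRegularity.Theorems.halfHolderEnergy_assembly_proof` (its module imports this route file, so no `_holds` link can be stated here).

/-! D-0027 §2.1 — DECIDING THEOREM (planner-authored via `route open/edit --closes-file`; by planner-ns-idea-9-g0-0 2026-08-28T03:10:27Z):
its hypotheses are this route's items and its conclusion the sub-problem Statement (glue_lint), and it elaborates with this file. -/

@[closes "route-NavierStokesRegularity-HalfHolderEnergy"] theorem closes (hH : EnergyHalfHolder) (hB : HolderBridge) (hL : NoLocalTypeISingularity) :
    NavierStokesRegularity := by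
  refine Summit.NavierStokesRegularity.NavierStokesRegularity.Theorems.navierStokesRegularity_of_noBlowup ?_
  intro ν T hν hT u p hcl hLH hdec
  by_contra hext
  exact hL (hB ν T hν hT u p ⟨hcl, hext⟩ hLH hdec (hH ν T hν hT u p ⟨hcl, hext⟩ hLH hdec))

end Summit.NavierStokesRegularity.NavierStokesRegularity.Theses.HalfHolderEnergy
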